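import Summits.QuantumFields.YangMills.Theorems.BalabanUVNodesN15TwoSpacingGluingNeumannPartition
import Summits.QuantumFields.YangMills.Theorems.BalabanUVNodesN15TwoSpacingGluingCutRowsMargin
import Summits.QuantumFields.YangMills.Theorems.BalabanUVNodesN15NeumannCubeConvolution
import Summits.QuantumFields.YangMills.Theorems.BalabanUVNodesN15TwoGridAveragingDefect
import HarnessLib

/-!
# THE GLUING STEP AT TWO LATTICE SPACINGS, XXVII: THE REMAINDER ROW OF ONE NEUMANN CUBE OF THE COVER — `[Δ_a, M_{h_k}]∘G(□_k) ≤ 1_{□_k}(y′)·Θ_w·e^{−ρ|y−y′|_T}` ON THE DOUBLED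
# TORUS AT ANY SPACING `n`, from dag-n15-a's (1.110) letters of the torus propagator and of `∂Π∂*`; `Θ_w = O(w⁻¹)` (dag-n15-c g12, FILE 69; N15 = NE2, s1 «background-layer OPERATOR
# ingredient»)

Cell `pub-ymgap`, seat `pub-ymgap-dag-n15-c` (R134 (a); HUMAN RULING D-0062), generation 12.  `bears_on: R4∕N15 · K3⁷ SpineGivenEndpointR13SepCoPH (stmt-QuantumFields-20544)`.
Filed `--supports stmt-QuantumFields-20544 --as helper` — COUNT-NEUTRAL.  Theorems only (0 `def`, 0 `sorry`).  Imports BY NAME FILES 67∕68 (cover partition letters, margin split; through them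
43–66), dag-n15-a N-IIi `…N15NeumannCubeConvolution` (through it N-IIIa∕b∕c, N-IIf: the images cube and its rows) and part 43 `…N15TwoGridAveragingDefect` (`Q`, `Q*` keep block majorants);
nothing in the tree is modified.

WHY.  FILE 45's remainder `R = −Σ_k [Δ_a, M_{h_k}]∘G(□_k)∘M_{h_k}` needs, per cube, the INPUT-localized row `[Δ_a, M_{h_k}]∘G(□_k) ≤ 1_{□_k}(y′)·θ₀·e^{−ρd}` with `θ₀` SMALL.  Bałaban's `Δ_a =
Σ∇*∇ + aQ*Q − ∂Π∂*` (FILE 62 `deltaOp_eq_lapOp_add`) splits as `Δ_loc + N′`, `Δ_loc = Σ_μ∇*_μ∇_μ` (range one), `N′ = aQ*Q − ∂Π∂*` (block range one + exponential tail):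
* LOCAL part — FILE 63 `hasMaj_commOp_lapOp_comp_of_cut` at `W := 0` on dag-n15-a's CUT rows `M_χG(□)` (N-IIIb), `M_χ∇_μG(□)` (N-IIIc, `symbOp_sD_eq`), `M_χ∇⁻_μG(□)` (N-IIf, ★ `bgrad_eq_neg_symbOp`),
  the cover's `c₁ = π∕w`, `c₂ = 32π²∕w²` (FILE 67) and cuts `M_{∇h} = M_{∇h}M_χ` (FILES 65∕66): `θ₁ = (d+1)(c₂β + 2c₁β₁)`;
* NONLOCAL part — FILE 68's margin split: `M_χ[N′, M_h]G(□)` is dag-n15-a N-IIi `hasMaj_chiCube_comp_neumannCubeG` with `T₁ := [N′, M_h] ≤ (ℓ(eε)⁻¹ + 2ω)c_N·e^{−(δ_m−ε)d}` (FILE 56 with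
  FILE 67's `ℓ = ω = π(d+1)∕w`; ★ `hasMaj_nonlocalPart`: `N′ ≤ c_N e^{−δ_m d}`, `c_N = |a|e^{2δ_m} + C₁` from part 43's `Q`∕`Q*` transfer and the `∂Π∂*` letter); `M_{1−χ}N′M_h` is FILE 68
  `hasMaj_far_sandwich` with FILE 66's margin `≥ m₀ + 1`: `θ₃ = c_N e^{−(δ_m∕4)(m₀+1)}`.
★★★ `hasMaj_commOp_deltaOp_comp_neumannCubeG`: for every cube `k` of the cover, `[Δ_a, M_{h_k}]∘G(□_k) ≤ 1_{□_k}(y′)·(θ₁ + θ₂ + θ₃βc_r)·e^{−(δ_m∕2)d}`, `δ_m = min δ₀ δ₁`, every letter an INPUT: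
the torus propagator's entries 0∕1 (`C, δ₀`) and `∂Π∂*`'s (`C₁, δ₁`) — supplied at both spacings by dag-n15-a `ineq110_114_pair` + `hasMaj_gOp_of_ineq`∕`hasMaj_grad_of_ineq` and `hasMaj_landauRe`.
* §1 bridges ★ `bgrad_eq_neg_symbOp`, `deltaOp_eq_lapOp_zero_add`, `commOp_zero_left`; §2 ★ `hasMaj_qq`, ★ `hasMaj_nonlocalPart`; §3 ★★ `hasMaj_commOp_lapOp_comp_cover` (local part), ★★
  `hasMaj_chiCube_commOp_comp_cover` (commutator half), ★★ `hasMaj_far_cover` (margin half), ★★★ `hasMaj_commOp_deltaOp_comp_neumannCubeG`.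

HONEST FRAMING ∕ LIMITS.  Block-majorant bookkeeping over LANDED letters ([B5] (1.69) p.29, (1.121) p.37, (1.126)–(1.128) p.38; [B6] (2.92)–(2.93) p.239, (2.133)–(2.135) p.247 = SHAPES ∕
MECHANISM); `U ≡ 1` doubled-cube torus MODEL of dag-n15-a (cube = half torus); nothing of [B5]∕[B6]∕[B9] asserted.  NE2⁺ NOT PRINTED, NOT proved; N15 NOT discharged; counts of record
UNMOVED (typed 28∕28 · discharged 5∕27); one finite 𝕋⁴ at fixed ε — NOT infinite volume, NOT OS on ℝ⁴, NOT a mass gap, NOT Clay; R4 closes the conditional finite-𝕋⁴ rung `BalabanLadder.UV`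
only.  Restate-immune (no Theses import).
-/

noncomputable section

namespace Summit.QuantumFields.YangMills.BalabanUVNodes.N15.Gluing

open Real
open Literature.MathematicalPhysics.QuantumFieldTheory.Balaban1983to89
open Literature.MathematicalPhysics.QuantumFieldTheory.Balaban1983to89.B5Prop11Plancherel (Tor fine unitVec)
open Literature.MathematicalPhysics.QuantumFieldTheory.Balaban1983to89.B11SectG (BlockNorm HasMaj RowSum hasMaj_zero)
open Literature.MathematicalPhysics.QuantumFieldTheory.Balaban1983to89.B6RandomWalk (Triangle254)
open Literature.MathematicalPhysics.QuantumFieldTheory.Balaban1983to89.B6Prop26Gluing (mulOp mulOp_apply ind ind_nonneg ind_le_one)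
open Literature.MathematicalPhysics.QuantumFieldTheory.Balaban1983to89.B6UnitTorusCarrier (unitTorusGeo triangle254_unitTorusGeo rowSum_unitTorusGeo unitTorusGeo_dist_nonneg
  unitTorusGeo_dist_symm unitTorusGeo_dist_self)
open Literature.MathematicalPhysics.QuantumFieldTheory.Balaban1983to89.B9Eq3130MatrixLetters (hasMaj_id_ofBlocks)
open Literature.MathematicalPhysics.QuantumFieldTheory.King1986.Torus (blockOf tdistT tdistT_nonneg)
open Summit.QuantumFields.YangMills.BalabanUVNodes.N15.BackgroundLayer (fgrad fgradAdj bgrad fgrad_apply bgrad_apply symbOp_sD_eq)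
open Summit.QuantumFields.YangMills.BalabanUVNodes.N15.VectorPiece (bshiftEquiv bshiftEquiv_apply bshiftEquiv_symm_apply)
open Summit.QuantumFields.YangMills.BalabanUVNodes.N15.TwoGrid (symbOp symbOp_single_apply sT sTinv sD deltaOp landauRe qvRe qvAdjRe gOp neumannCubeG chiCube cubeBlocks
  abs_chiCube_le_one chiCube_of_not_mem hasMaj_chiCube_symOp_comp hasMaj_comp_mulOp_chiInt hasMaj_chiCube_grad_neumannCubeG_of hasMaj_chiCube_divAdjOut_neumannCubeG_of
  hasMaj_chiCube_comp_neumannCubeG hasMaj_qvRe_comp hasMaj_qvAdjRe_comp hasMaj_smul_ofBlocks)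

variable {d : ℕ}

/-! ## §1 Bridges between this lineage's lattice calculus and dag-n15-a's symbol calculus -/

section Bridges

variable (M : Fin (d + 1) → ℕ) [∀ μ, NeZero (M μ)] (n : ℕ) [NeZero n]

omit [∀ μ, NeZero (M μ)] [NeZero n] in
/-- ★ `∇⁻_μ = −ρ(n•(s_μ⁻¹ − 1))`: this lineage's backward quotient is MINUS dag-n15-a's adjoint-output symbol. [folklore] -/
theorem bgrad_eq_neg_symbOp (μ : Fin (d + 1)) : bgrad (n : ℝ) (bshiftEquiv M n μ) = -symbOp M n ((n : ℝ) • (sTinv M n μ - 1)) := by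
  refine LinearMap.ext fun f => funext fun i => ?_
  rw [bgrad_apply, LinearMap.neg_apply, Pi.neg_apply, map_smul, map_sub, map_one, LinearMap.smul_apply, LinearMap.sub_apply, Pi.smul_apply, Pi.sub_apply, sTinv,
    symbOp_single_apply, one_mul, bshiftEquiv_symm_apply, smul_eq_mul, Module.End.one_apply, sub_eq_add_neg i.1]
  ring

/-- `Δ_a = (Σ_μ∇*_μ∇_μ + 0) + (aQ*Q − ∂Π∂*)`: FILE 62's decomposition with the block-range-one `aQ*Q` moved into the nonlocal part. [cite: Balaban1984PropagatorsI, (1.69) p.29] -/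
theorem deltaOp_eq_lapOp_zero_add (a : ℝ) :
    deltaOp M n a = lapOp (n : ℝ) (bshiftEquiv M n) 0 + (a • (qvAdjRe M n ∘ₗ qvRe M n) + (-landauRe M n)) := by
  rw [deltaOp_eq_lapOp_add, lapOp, lapOp]
  abel

omit [∀ μ, NeZero (M μ)] [NeZero n] in
/-- `[0, M_h] = 0`. [folklore] -/
theorem commOp_zero_left {X : Type} (h : X → ℝ) : commOp (0 : (X → ℝ) →ₗ[ℝ] (X → ℝ)) h = 0 := by
  rw [commOp, LinearMap.zero_comp, LinearMap.comp_zero, sub_zero]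

end Bridges

/-! ## §2 The nonlocal part `N′ = aQ*Q − ∂Π∂*` and its letter -/

section Nonlocal

variable {M : Fin (d + 1) → ℕ} [∀ μ, NeZero (M μ)] {L kk n : ℕ} [NeZero n]

/-- ★ **`Q*Q` KEEPS AN EXPONENTIAL LETTER** (block range one): `Q*Q ≤ e^{2ρ}·e^{−ρd}` for every `ρ ≥ 0`. [cite: Balaban1984PropagatorsI, (1.18) p.20 (the stencils of Q, Q*)] -/
theorem hasMaj_qq {ρ : ℝ} (hρ : 0 ≤ ρ) :
    HasMaj (BlockNorm.ofBlocks (unitTorusGeo L kk M) (fun b : Tor (fine n M) × Fin (d + 1) => blockOf n M b.1))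
      (BlockNorm.ofBlocks (unitTorusGeo L kk M) (fun b : Tor (fine n M) × Fin (d + 1) => blockOf n M b.1)) (qvAdjRe M n ∘ₗ qvRe M n)
      (fun y y' => Real.exp ρ * Real.exp ρ * Real.exp (-(ρ * tdistT M y y'))) := by
  have h0 := hasMaj_id_ofBlocks (g := unitTorusGeo L kk M) (fun b : Tor (fine n M) × Fin (d + 1) => blockOf n M b.1) (unitTorusGeo_dist_self (L := L) (k := kk) (M := M)) ρ
  have h1 := hasMaj_qvRe_comp M kk n zero_le_one hρ h0
  have h2 := hasMaj_qvAdjRe_comp M kk n (by positivity) hρ h1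
  rw [LinearMap.comp_id] at h2
  exact h2.mono fun y y' => by simp only [one_mul]; exact le_rfl

/-- ★ **THE LETTER OF THE NONLOCAL PART**: `∂Π∂* ≤ C₁e^{−δ₁d}` and `δ_N ≤ δ₁`, `δ_N ≥ 0` ⟹ `N′ = aQ*Q − ∂Π∂* ≤ (|a|e^{2δ_N} + C₁)·e^{−δ_N d}`. [cite: Balaban1984PropagatorsI, (1.69) p.29, (1.126) p.38 (shapes)] -/
theorem hasMaj_nonlocalPart {a C₁ δ₁ δN : ℝ} (hC₁ : 0 ≤ C₁) (hδN : 0 ≤ δN) (hδ : δN ≤ δ₁)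
    (hNL : HasMaj (BlockNorm.ofBlocks (unitTorusGeo L kk M) (fun b : Tor (fine n M) × Fin (d + 1) => blockOf n M b.1))
      (BlockNorm.ofBlocks (unitTorusGeo L kk M) (fun b : Tor (fine n M) × Fin (d + 1) => blockOf n M b.1)) (landauRe M n) (fun y y' => C₁ * Real.exp (-(δ₁ * tdistT M y y')))) :
    HasMaj (BlockNorm.ofBlocks (unitTorusGeo L kk M) (fun b : Tor (fine n M) × Fin (d + 1) => blockOf n M b.1))
      (BlockNorm.ofBlocks (unitTorusGeo L kk M) (fun b : Tor (fine n M) × Fin (d + 1) => blockOf n M b.1)) (a • (qvAdjRe M n ∘ₗ qvRe M n) + (-landauRe M n))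
      (fun y y' => (|a| * (Real.exp δN * Real.exp δN) + C₁) * Real.exp (-(δN * tdistT M y y'))) := by
  have hq := hasMaj_smul_ofBlocks (g := unitTorusGeo L kk M) (fun b : Tor (fine n M) × Fin (d + 1) => blockOf n M b.1) (fun y y' => by positivity) a (hasMaj_qq (L := L) (kk := kk) hδN)
  refine (hq.add hNL.neg).mono fun y y' => ?_
  have hexp : Real.exp (-(δ₁ * tdistT M y y')) ≤ Real.exp (-(δN * tdistT M y y')) := Real.exp_le_exp.mpr (by nlinarith [tdistT_nonneg M y y'])
  have := mul_le_mul_of_nonneg_left hexp hC₁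
  nlinarith [Real.exp_nonneg (-(δN * tdistT M y y')), Real.exp_nonneg δN, abs_nonneg a]

end Nonlocal

/-! ## §3 The remainder row of one cube of the cover -/

section Row

variable {M : Fin (d + 1) → ℕ} [∀ μ, NeZero (M μ)] {L kk n w q m₀ : ℕ} [NeZero n]

/-- rate weakening of an exponential block majorant (`d ≥ 0`). [folklore] -/
theorem hasMaj_rate_le {F₁ : Type} [AddCommGroup F₁] [Module ℝ F₁] {b₁ : BlockNorm (unitTorusGeo L kk M) F₁} {T : F₁ →ₗ[ℝ] (Tor (fine n M) × Fin (d + 1) → ℝ)}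
    {P : Tor M → Tor M → ℝ} {θ δ δ' : ℝ} (hP : ∀ y y', 0 ≤ P y y') (hθ : 0 ≤ θ) (hδ : δ' ≤ δ)
    (h : HasMaj b₁ (BlockNorm.ofBlocks (unitTorusGeo L kk M) (fun b : Tor (fine n M) × Fin (d + 1) => blockOf n M b.1)) T (fun y y' => P y y' * (θ * Real.exp (-(δ * tdistT M y y'))))) :
    HasMaj b₁ (BlockNorm.ofBlocks (unitTorusGeo L kk M) (fun b : Tor (fine n M) × Fin (d + 1) => blockOf n M b.1)) T (fun y y' => P y y' * (θ * Real.exp (-(δ' * tdistT M y y')))) :=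
  h.mono fun y y' => mul_le_mul_of_nonneg_left (mul_le_mul_of_nonneg_left (Real.exp_le_exp.mpr (by nlinarith [tdistT_nonneg M y y'])) hθ) (hP y y')

/-- ★★ **THE LOCAL PART** `[Σ_μ∇*_μ∇_μ, M_{h_k}]∘G(□_k) ≤ 1_□1_□·θ₁·e^{−δ₀d}`, `θ₁ = (d+1)(c₂β + 2c₁β₁)`, `c₁ = π∕w`, `c₂ = 32π²∕w²`, `β = 2^{d+1}Ce^{δ₀}`, `β₁ = βe^{δ₀}` — FILE 63 `hasMaj_commOp_lapOp_comp_of_cut`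
at `W := 0` on dag-n15-a's cut rows (N-IIIb, N-IIIc, N-IIf) with the cover's partition letters (FILE 67) and cuts (FILES 65∕66). [cite: Balaban1984PropagatorsII, (2.133)–(2.134) p.247 (shapes + mechanism)] -/
theorem hasMaj_commOp_lapOp_comp_cover (hM : ∀ ν, M ν = 2 * q * w) (hw : 0 < w) (hfit : m₀ + 2 * w + 1 ≤ q * w) {a C δ₀ : ℝ} (hC : 0 < C) (hδ₀ : 0 < δ₀)
    (hG : HasMaj (BlockNorm.ofBlocks (unitTorusGeo L kk M) (fun b : Tor (fine n M) × Fin (d + 1) => blockOf n M b.1))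
      (BlockNorm.ofBlocks (unitTorusGeo L kk M) (fun b : Tor (fine n M) × Fin (d + 1) => blockOf n M b.1)) (gOp M n a) (fun y y' => C * Real.exp (-(δ₀ * tdistT M y y'))))
    (hD : ∀ ν, HasMaj (BlockNorm.ofBlocks (unitTorusGeo L kk M) (fun b : Tor (fine n M) × Fin (d + 1) => blockOf n M b.1))
      (BlockNorm.ofBlocks (unitTorusGeo L kk M) (fun b : Tor (fine n M) × Fin (d + 1) => blockOf n M b.1))
      (symbOp M n (sD M n ν (n : ℝ)) ∘ₗ gOp M n a) (fun y y' => C * Real.exp (-(δ₀ * tdistT M y y'))))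
    (k : Fin (d + 1) → ZMod (2 * q)) :
    HasMaj (BlockNorm.ofBlocks (unitTorusGeo L kk M) (fun b : Tor (fine n M) × Fin (d + 1) => blockOf n M b.1))
      (BlockNorm.ofBlocks (unitTorusGeo L kk M) (fun b : Tor (fine n M) × Fin (d + 1) => blockOf n M b.1))
      (commOp (lapOp (n : ℝ) (bshiftEquiv M n) 0) (hcube (2 * q) (coverXi M n w) k) ∘ₗ neumannCubeG M n (coverCorner M w q m₀ k) (q * w) a)
      (fun y y' => ind ((cubeBlocks M (coverCorner M w q m₀ k) (q * w) : Finset (Tor M)) : Set (Tor M)) y *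
        ind ((cubeBlocks M (coverCorner M w q m₀ k) (q * w) : Finset (Tor M)) : Set (Tor M)) y' *
        (((d + 1 : ℕ) * (32 * π ^ 2 / (w : ℝ) ^ 2 * (2 ^ (d + 1) * (C * Real.exp δ₀)) + 2 * (π / w * (2 ^ (d + 1) * (C * Real.exp δ₀ * Real.exp δ₀)))) + 0) *
          Real.exp (-(δ₀ * tdistT M y y')))) := by
  have hM' : ∀ ν, M ν = 2 * (q * w) := fun ν => by rw [hM ν, mul_assoc]
  have hχ := fun μ => chiCube_coverCorner_eq_one (M := M) (n := n) (m₀ := m₀) hM hw hfit μ k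
  -- the cut rows of dag-n15-a
  have hGc := hasMaj_chiCube_symOp_comp (L := L) (k := kk) (c := coverCorner M w q m₀ k) (S := q * w) hC.le hδ₀.le hM'
    (hasMaj_comp_mulOp_chiInt (c := coverCorner M w q m₀ k) (S := q * w) hC.le hG)
  have hDc : ∀ μ, HasMaj (BlockNorm.ofBlocks (unitTorusGeo L kk M) (fun b : Tor (fine n M) × Fin (d + 1) => blockOf n M b.1))
      (BlockNorm.ofBlocks (unitTorusGeo L kk M) (fun b : Tor (fine n M) × Fin (d + 1) => blockOf n M b.1))
      (mulOp (chiCube M n (coverCorner M w q m₀ k) (q * w)) ∘ₗ (fgrad (n : ℝ) (bshiftEquiv M n μ) ∘ₗ neumannCubeG M n (coverCorner M w q m₀ k) (q * w) a))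
      (fun y y' => ind ((cubeBlocks M (coverCorner M w q m₀ k) (q * w) : Finset (Tor M)) : Set (Tor M)) y *
        ind ((cubeBlocks M (coverCorner M w q m₀ k) (q * w) : Finset (Tor M)) : Set (Tor M)) y' * (2 ^ (d + 1) * (C * Real.exp δ₀ * Real.exp δ₀) * Real.exp (-(δ₀ * tdistT M y y')))) := by
    intro μ
    have h := hasMaj_chiCube_grad_neumannCubeG_of (L := L) (k := kk) (c := coverCorner M w q m₀ k) (S := q * w) hM' hC hδ₀ μ (hD μ)
    rw [symbOp_sD_eq] at h
    exact h
  have hDbc : ∀ μ, HasMaj (BlockNorm.ofBlocks (unitTorusGeo L kk M) (fun b : Tor (fine n M) × Fin (d + 1) => blockOf n M b.1))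
      (BlockNorm.ofBlocks (unitTorusGeo L kk M) (fun b : Tor (fine n M) × Fin (d + 1) => blockOf n M b.1))
      (mulOp (chiCube M n (coverCorner M w q m₀ k) (q * w)) ∘ₗ (bgrad (n : ℝ) (bshiftEquiv M n μ) ∘ₗ neumannCubeG M n (coverCorner M w q m₀ k) (q * w) a))
      (fun y y' => ind ((cubeBlocks M (coverCorner M w q m₀ k) (q * w) : Finset (Tor M)) : Set (Tor M)) y *
        ind ((cubeBlocks M (coverCorner M w q m₀ k) (q * w) : Finset (Tor M)) : Set (Tor M)) y' * (2 ^ (d + 1) * (C * Real.exp δ₀ * Real.exp δ₀) * Real.exp (-(δ₀ * tdistT M y y')))) := by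
    intro μ
    have h := (hasMaj_chiCube_divAdjOut_neumannCubeG_of (L := L) (k := kk) (c := coverCorner M w q m₀ k) (S := q * w) hM' hC.le hδ₀.le μ (hD μ)).neg
    rw [bgrad_eq_neg_symbOp, LinearMap.neg_comp, LinearMap.comp_neg]
    exact h
  have hW : HasMaj (BlockNorm.ofBlocks (unitTorusGeo L kk M) (fun b : Tor (fine n M) × Fin (d + 1) => blockOf n M b.1))
      (BlockNorm.ofBlocks (unitTorusGeo L kk M) (fun b : Tor (fine n M) × Fin (d + 1) => blockOf n M b.1))
      (commOp (0 : (Tor (fine n M) × Fin (d + 1) → ℝ) →ₗ[ℝ] (Tor (fine n M) × Fin (d + 1) → ℝ)) (hcube (2 * q) (coverXi M n w) k) ∘ₗ neumannCubeG M n (coverCorner M w q m₀ k) (q * w) a)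
      (fun y y' => ind ((cubeBlocks M (coverCorner M w q m₀ k) (q * w) : Finset (Tor M)) : Set (Tor M)) y *
        ind ((cubeBlocks M (coverCorner M w q m₀ k) (q * w) : Finset (Tor M)) : Set (Tor M)) y' * (0 * Real.exp (-(δ₀ * tdistT M y y')))) := by
    rw [commOp_zero_left, LinearMap.zero_comp]
    exact (hasMaj_zero _ _).mono fun y y' => le_of_eq (by ring)
  have key := hasMaj_commOp_lapOp_comp_of_cut (g := unitTorusGeo L kk M) (fun b : Tor (fine n M) × Fin (d + 1) => blockOf n M b.1) (J := Fin (d + 1))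
    (e := bshiftEquiv M n) (n := (n : ℝ)) (by positivity : (0 : ℝ) ≤ π / w) (by positivity : (0 : ℝ) ≤ 32 * π ^ 2 / (w : ℝ) ^ 2)
    (fun μ x => abs_fgrad_coverH_le hM hw k μ x) (fun μ x => abs_bgrad_coverH_le hM hw k μ x) (fun μ x => abs_fgradAdj_fgrad_coverH_le hM hw k μ x)
    (fun μ => fgradAdj_fgrad_hcube_cut (2 * q) (coverXi M n w) (bshiftEquiv M n) μ (n : ℝ) (hχ μ))
    (fun μ => fgrad_hcube_cut (2 * q) (coverXi M n w) (bshiftEquiv M n) μ (n : ℝ) (hχ μ))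
    (fun μ => bgrad_hcube_cut (2 * q) (coverXi M n w) (bshiftEquiv M n) μ (n : ℝ) (hχ μ)) hGc hDc hDbc hW
  refine key.mono fun y y' => le_of_eq ?_
  rw [Fintype.card_fin]

/-- ★★ **THE COMMUTATOR HALF BEHIND THE OUTPUT CUT**: `M_{χ_k}∘[N′, M_{h_k}]∘G(□_k) ≤ 1_□1_□·θ₂·e^{−(δ_m∕2)d}`, `θ₂ = 2^{d+1}·a₁·Ce^{δ₀}·c_r`, `a₁ = (ℓ(e·δ_m∕4)⁻¹ + 2ω)·c_N`, `ℓ = ω = π(d+1)∕w`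
— dag-n15-a N-IIi `hasMaj_chiCube_comp_neumannCubeG` with `T₁ := [N′, M_{h_k}]`, small by FILE 56 `hasMaj_commOp_nonlocal` and FILE 67's moduli. [cite: Balaban1984PropagatorsI, (1.128) p.38 (mechanism); Balaban1984PropagatorsII, (2.134) p.247 (shape)] -/
theorem hasMaj_chiCube_commOp_comp_cover (hM : ∀ ν, M ν = 2 * q * w) (hw : 0 < w) {a C δ₀ C₁ δ₁ : ℝ} (hC : 0 < C) (hδ₀ : 0 < δ₀) (hC₁ : 0 ≤ C₁) (hδ₁ : 0 < δ₁)
    (hG : HasMaj (BlockNorm.ofBlocks (unitTorusGeo L kk M) (fun b : Tor (fine n M) × Fin (d + 1) => blockOf n M b.1))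
      (BlockNorm.ofBlocks (unitTorusGeo L kk M) (fun b : Tor (fine n M) × Fin (d + 1) => blockOf n M b.1)) (gOp M n a) (fun y y' => C * Real.exp (-(δ₀ * tdistT M y y'))))
    (hNL : HasMaj (BlockNorm.ofBlocks (unitTorusGeo L kk M) (fun b : Tor (fine n M) × Fin (d + 1) => blockOf n M b.1))
      (BlockNorm.ofBlocks (unitTorusGeo L kk M) (fun b : Tor (fine n M) × Fin (d + 1) => blockOf n M b.1)) (landauRe M n) (fun y y' => C₁ * Real.exp (-(δ₁ * tdistT M y y'))))
    (k : Fin (d + 1) → ZMod (2 * q)) :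
    HasMaj (BlockNorm.ofBlocks (unitTorusGeo L kk M) (fun b : Tor (fine n M) × Fin (d + 1) => blockOf n M b.1))
      (BlockNorm.ofBlocks (unitTorusGeo L kk M) (fun b : Tor (fine n M) × Fin (d + 1) => blockOf n M b.1))
      (mulOp (chiCube M n (coverCorner M w q m₀ k) (q * w)) ∘ₗ
        (commOp (a • (qvAdjRe M n ∘ₗ qvRe M n) + (-landauRe M n)) (hcube (2 * q) (coverXi M n w) k) ∘ₗ neumannCubeG M n (coverCorner M w q m₀ k) (q * w) a))
      (fun y y' => ind ((cubeBlocks M (coverCorner M w q m₀ k) (q * w) : Finset (Tor M)) : Set (Tor M)) y *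
        ind ((cubeBlocks M (coverCorner M w q m₀ k) (q * w) : Finset (Tor M)) : Set (Tor M)) y' *
        (2 ^ (d + 1) * ((π * (d + 1) / w * (Real.exp 1 * (min δ₀ δ₁ / 4))⁻¹ + 2 * (π * (d + 1) / w)) * (|a| * (Real.exp (min δ₀ δ₁) * Real.exp (min δ₀ δ₁)) + C₁) *
          (C * Real.exp δ₀) * B4Sect5Proof.latticeConst (d + 1) (min δ₀ δ₁ / 4)) * Real.exp (-(min δ₀ δ₁ / 2 * tdistT M y y')))) := by
  have hM' : ∀ ν, M ν = 2 * (q * w) := fun ν => by rw [hM ν, mul_assoc]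
  have hδm : 0 < min δ₀ δ₁ := lt_min hδ₀ hδ₁
  have hN' := hasMaj_nonlocalPart (L := L) (kk := kk) (a := a) hC₁ hδm.le (min_le_right δ₀ δ₁) hNL
  have hcN : 0 ≤ |a| * (Real.exp (min δ₀ δ₁) * Real.exp (min δ₀ δ₁)) + C₁ := by positivity
  have h1 := hasMaj_commOp_nonlocal (g := unitTorusGeo L kk M) (fun b : Tor (fine n M) × Fin (d + 1) => blockOf n M b.1) (h := hcube (2 * q) (coverXi M n w) k)
    (hb := coverHb M n w q k) hcN (by positivity : (0 : ℝ) ≤ π * (d + 1) / w) (by positivity : (0 : ℝ) ≤ π * (d + 1) / w) (by positivity : (0 : ℝ) < min δ₀ δ₁ / 4)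
    (unitTorusGeo_dist_nonneg L kk M) (unitTorusGeo_dist_symm L kk M) (fun y y' => abs_coverHb_sub_le hM hw k y y') (fun x => abs_coverH_sub_coverHb_le hM hw k x) hN'
  have hrow := rowSum_unitTorusGeo (L := L) (k := kk) (M := M) (σ := min δ₀ δ₁ / 4) (by positivity)
  exact hasMaj_chiCube_comp_neumannCubeG (c := coverCorner M w q m₀ k) (S := q * w) hM' (triangle254_unitTorusGeo L kk M) hrow hC.le hδ₀.le (by positivity)
    (by positivity : (0 : ℝ) ≤ min δ₀ δ₁ / 2) (by linarith [min_le_left δ₀ δ₁] : min δ₀ δ₁ / 2 ≤ δ₀) (by linarith : min δ₀ δ₁ / 2 + min δ₀ δ₁ / 4 ≤ min δ₀ δ₁ - min δ₀ δ₁ / 4) h1 hG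

/-- ★★ **THE FAR HALF, SMALL IN THE MARGIN**: `M_{1−χ_k}∘N′∘M_{h_k} ≤ c_N e^{−(δ_m∕4)(m₀+1)}·e^{−(3δ_m∕4)d}` — FILE 68 `hasMaj_far_sandwich` with FILE 66 `margin_le_tdistT` (a block outside `□_k` and a block of
`supp h_k` are `≥ m₀ + 1` apart). [cite: Balaban1984PropagatorsII, (2.93) p.239 («ζ_□ … distance ⅓M to the boundary of □»: mechanism)] -/
theorem hasMaj_far_cover (hM : ∀ ν, M ν = 2 * q * w) (hw : 0 < w) (hfit : 2 * m₀ + 2 * w + 1 ≤ q * w) {a C₁ δ₁ δ₀ : ℝ} (hC₁ : 0 ≤ C₁) (hδ₀ : 0 < δ₀) (hδ₁ : 0 < δ₁)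
    (hNL : HasMaj (BlockNorm.ofBlocks (unitTorusGeo L kk M) (fun b : Tor (fine n M) × Fin (d + 1) => blockOf n M b.1))
      (BlockNorm.ofBlocks (unitTorusGeo L kk M) (fun b : Tor (fine n M) × Fin (d + 1) => blockOf n M b.1)) (landauRe M n) (fun y y' => C₁ * Real.exp (-(δ₁ * tdistT M y y'))))
    (k : Fin (d + 1) → ZMod (2 * q)) :
    HasMaj (BlockNorm.ofBlocks (unitTorusGeo L kk M) (fun b : Tor (fine n M) × Fin (d + 1) => blockOf n M b.1))
      (BlockNorm.ofBlocks (unitTorusGeo L kk M) (fun b : Tor (fine n M) × Fin (d + 1) => blockOf n M b.1))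
      (mulOp (1 - chiCube M n (coverCorner M w q m₀ k) (q * w)) ∘ₗ (a • (qvAdjRe M n ∘ₗ qvRe M n) + (-landauRe M n)) ∘ₗ mulOp (hcube (2 * q) (coverXi M n w) k))
      (fun y y' => (|a| * (Real.exp (min δ₀ δ₁) * Real.exp (min δ₀ δ₁)) + C₁) * Real.exp (-((min δ₀ δ₁ - (min δ₀ δ₁ - min δ₀ δ₁ / 4)) * ((m₀ : ℝ) + 1))) *
        Real.exp (-((min δ₀ δ₁ - min δ₀ δ₁ / 4) * tdistT M y y'))) := by
  have hδm : 0 < min δ₀ δ₁ := lt_min hδ₀ hδ₁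
  have hN' := hasMaj_nonlocalPart (L := L) (kk := kk) (a := a) hC₁ hδm.le (min_le_right δ₀ δ₁) hNL
  have hcN : 0 ≤ |a| * (Real.exp (min δ₀ δ₁) * Real.exp (min δ₀ δ₁)) + C₁ := by positivity
  refine hasMaj_far_sandwich (g := unitTorusGeo L kk M) (fun b : Tor (fine n M) × Fin (d + 1) => blockOf n M b.1)
    (A := ((cubeBlocks M (coverCorner M w q m₀ k) (q * w) : Finset (Tor M)) : Set (Tor M)))
    (H := {y : Tor M | ∀ ν, m₀ ≤ ((y - coverCorner M w q m₀ k) ν).val ∧ ((y - coverCorner M w q m₀ k) ν).val + 1 ≤ m₀ + 2 * w})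
    hcN (by linarith) (fun x => ?_) (fun x hx => ?_) (fun x => abs_coverH_le_one k x) (fun x hx => ?_) (fun y y' hy hy' => ?_) hN'
  · simp only [Pi.sub_apply, Pi.one_apply]
    unfold chiCube; split_ifs <;> norm_num
  · simp only [Pi.sub_apply, Pi.one_apply]
    unfold chiCube; rw [if_pos (Finset.mem_coe.mp hx), sub_self]
  · by_contra hne
    exact hx fun ν => val_blockOf_sub_of_hcube_ne_zero (m₀ := m₀) hM hw (by nlinarith) hne ν
  · exact margin_le_tdistT hM hfit (fun h => hy (Finset.mem_coe.mpr h)) hy'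

/-- ★★★ **THE REMAINDER ROW OF ONE CUBE OF THE COVER**: for every cube `k`, at any spacing `n`, on the doubled torus `M_ν = 2qw` with margin `2m₀ + 2w + 1 ≤ qw`,
`[Δ_a, M_{h_k}]∘G(□_k) ≤ 1_{□_k}(y′)·(θ₁ + θ₂ + θ₃·β·c_r)·e^{−(δ_m∕2)|y−y′|_T}` (`δ_m = min δ₀ δ₁`), the INPUT-localized row FILE 45's remainder consumes (`hasMaj_remainder_in`), from the
torus letters of `G`, `∇G` (`C, δ₀`) and of `∂Π∂*` (`C₁, δ₁`) ONLY — `θ₁, θ₂ = O(w⁻¹)`, `θ₃ = O(e^{−(δ_m∕4)(m₀+1)})` (FILE 70 reads `θ₀ ≤ κ₀∕w`). [cite: Balaban1984PropagatorsII, (2.92)–(2.93) p.239, (2.134)–(2.135) p.247 (shapes + mechanism); Balaban1984PropagatorsI, (1.121)–(1.128) pp.37–38] -/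
theorem hasMaj_commOp_deltaOp_comp_neumannCubeG (hM : ∀ ν, M ν = 2 * q * w) (hw : 0 < w) (hfit : 2 * m₀ + 2 * w + 1 ≤ q * w) {a C δ₀ C₁ δ₁ : ℝ} (hC : 0 < C) (hδ₀ : 0 < δ₀)
    (hC₁ : 0 ≤ C₁) (hδ₁ : 0 < δ₁)
    (hG : HasMaj (BlockNorm.ofBlocks (unitTorusGeo L kk M) (fun b : Tor (fine n M) × Fin (d + 1) => blockOf n M b.1))
      (BlockNorm.ofBlocks (unitTorusGeo L kk M) (fun b : Tor (fine n M) × Fin (d + 1) => blockOf n M b.1)) (gOp M n a) (fun y y' => C * Real.exp (-(δ₀ * tdistT M y y'))))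
    (hD : ∀ ν, HasMaj (BlockNorm.ofBlocks (unitTorusGeo L kk M) (fun b : Tor (fine n M) × Fin (d + 1) => blockOf n M b.1))
      (BlockNorm.ofBlocks (unitTorusGeo L kk M) (fun b : Tor (fine n M) × Fin (d + 1) => blockOf n M b.1))
      (symbOp M n (sD M n ν (n : ℝ)) ∘ₗ gOp M n a) (fun y y' => C * Real.exp (-(δ₀ * tdistT M y y'))))
    (hNL : HasMaj (BlockNorm.ofBlocks (unitTorusGeo L kk M) (fun b : Tor (fine n M) × Fin (d + 1) => blockOf n M b.1))
      (BlockNorm.ofBlocks (unitTorusGeo L kk M) (fun b : Tor (fine n M) × Fin (d + 1) => blockOf n M b.1)) (landauRe M n) (fun y y' => C₁ * Real.exp (-(δ₁ * tdistT M y y'))))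
    (k : Fin (d + 1) → ZMod (2 * q)) :
    HasMaj (BlockNorm.ofBlocks (unitTorusGeo L kk M) (fun b : Tor (fine n M) × Fin (d + 1) => blockOf n M b.1))
      (BlockNorm.ofBlocks (unitTorusGeo L kk M) (fun b : Tor (fine n M) × Fin (d + 1) => blockOf n M b.1))
      (commOp (deltaOp M n a) (hcube (2 * q) (coverXi M n w) k) ∘ₗ neumannCubeG M n (coverCorner M w q m₀ k) (q * w) a)
      (fun y y' => ind ((cubeBlocks M (coverCorner M w q m₀ k) (q * w) : Finset (Tor M)) : Set (Tor M)) y' *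
        ((((d + 1 : ℕ) * (32 * π ^ 2 / (w : ℝ) ^ 2 * (2 ^ (d + 1) * (C * Real.exp δ₀)) + 2 * (π / w * (2 ^ (d + 1) * (C * Real.exp δ₀ * Real.exp δ₀)))) + 0) +
            2 ^ (d + 1) * ((π * (d + 1) / w * (Real.exp 1 * (min δ₀ δ₁ / 4))⁻¹ + 2 * (π * (d + 1) / w)) * (|a| * (Real.exp (min δ₀ δ₁) * Real.exp (min δ₀ δ₁)) + C₁) *
              (C * Real.exp δ₀) * B4Sect5Proof.latticeConst (d + 1) (min δ₀ δ₁ / 4)) +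
            (|a| * (Real.exp (min δ₀ δ₁) * Real.exp (min δ₀ δ₁)) + C₁) * Real.exp (-((min δ₀ δ₁ - (min δ₀ δ₁ - min δ₀ δ₁ / 4)) * ((m₀ : ℝ) + 1))) *
              (2 ^ (d + 1) * (C * Real.exp δ₀)) * B4Sect5Proof.latticeConst (d + 1) (min δ₀ δ₁ / 4)) *
          Real.exp (-(min δ₀ δ₁ / 2 * tdistT M y y')))) := by
  have hM' : ∀ ν, M ν = 2 * (q * w) := fun ν => by rw [hM ν, mul_assoc]
  have hδm : 0 < min δ₀ δ₁ := lt_min hδ₀ hδ₁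
  have hfit1 : m₀ + 2 * w + 1 ≤ q * w := by omega
  have hrow := rowSum_unitTorusGeo (L := L) (k := kk) (M := M) (σ := min δ₀ δ₁ / 4) (by positivity)
  have hcr : 0 ≤ B4Sect5Proof.latticeConst (d + 1) (min δ₀ δ₁ / 4) := hrow.nonneg (0 : Tor M)
  have hind : ∀ y y' : Tor M, 0 ≤ ind (g := unitTorusGeo L kk M) ((cubeBlocks M (coverCorner M w q m₀ k) (q * w) : Finset (Tor M)) : Set (Tor M)) y *
      ind (g := unitTorusGeo L kk M) ((cubeBlocks M (coverCorner M w q m₀ k) (q * w) : Finset (Tor M)) : Set (Tor M)) y' :=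
    fun y y' => mul_nonneg (ind_nonneg _ _) (ind_nonneg _ _)
  -- the local part and the cut row, weakened to the rate `δ_m ∕ 2`
  have hKloc := hasMaj_rate_le hind (by positivity) (by linarith [min_le_left δ₀ δ₁] : min δ₀ δ₁ / 2 ≤ δ₀) (hasMaj_commOp_lapOp_comp_cover (L := L) (kk := kk) hM hw hfit1 hC hδ₀ hG hD k)
  have hGc := hasMaj_rate_le hind (by positivity) (by linarith [min_le_left δ₀ δ₁] : min δ₀ δ₁ / 2 ≤ δ₀)
    (hasMaj_chiCube_symOp_comp (L := L) (k := kk) (c := coverCorner M w q m₀ k) (S := q * w) hC.le hδ₀.le hM' (hasMaj_comp_mulOp_chiInt (c := coverCorner M w q m₀ k) (S := q * w) hC.le hG))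
  have hCm := hasMaj_chiCube_commOp_comp_cover (L := L) (kk := kk) (m₀ := m₀) hM hw hC hδ₀ hC₁ hδ₁ hG hNL k
  have hFar := hasMaj_far_cover (L := L) (kk := kk) (a := a) hM hw hfit hC₁ hδ₀ hδ₁ hNL k
  have hcut := hcube_cut (2 * q) (coverXi M n w) (bshiftEquiv M n) 0 (chiCube_coverCorner_eq_one (M := M) (n := n) (m₀ := m₀) hM hw hfit1 0 k)
  rw [deltaOp_eq_lapOp_zero_add]
  exact hasMaj_commOp_comp_of_add_cut_margin (g := unitTorusGeo L kk M) (fun b : Tor (fine n M) × Fin (d + 1) => blockOf n M b.1) (triangle254_unitTorusGeo L kk M)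
    (unitTorusGeo_dist_nonneg L kk M) hrow (by positivity) (by positivity) (by positivity) (by positivity) (by positivity) le_rfl
    (by linarith : min δ₀ δ₁ / 2 + min δ₀ δ₁ / 4 ≤ min δ₀ δ₁ - min δ₀ δ₁ / 4) hcut hKloc hCm hFar hGc

end Row

end Summit.QuantumFields.YangMills.BalabanUVNodes.N15.Gluing

end
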